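import Literature.Analysis.FluidPDE.SereginSverakScaledEnergiesAtVertex
import Literature.Analysis.FluidPDE.Seregin2020BlowupLimit
import Literature.Analysis.FluidPDE.SuitableWeakInBallTools
import HarnessLib

/-!
# One-sided pressure bounds: the blow-up (zoom-in) limit at a point of the final slice

Analysis/FluidPDE proof file (theorems only; no definitions, no named facts) on the discharge
path of the named fact `Literature.Analysis.FluidPDE.seregin_sverak_2002`
(`SereginSverakPressure.lean`; G. Seregin, V. Šverák, *Navier–Stokes equations with lower bounds
on the pressure*, Arch. Ration. Mech. Anal. **163** (2002) 65–86). For a classical solution of the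
Navier–Stokes system on `[0, T) × ℝ³` (`ν = 1`) which is Leray–Hopf on `[0, T]`, with
`|u|²/2 + p̃ ≤ K` or `p̃ ≥ -K`, and a centre `x₀`, it produces the blow-up limit of the gauged pair
`(u, q)`, `q = p − (p(t, 0) − p̃[u(t)](0))`, at the vertex `(T, x₀)`:

* `SereginSverak2002.aestronglyMeasurable_gauge_slab` — the gauged pressure is a.e.-strongly
  measurable on the whole slab `(0, T) × ℝ³` (piecewise, from Tao's normalisation on the closed
  slabs `[0, T − T/(n+2)]`);
* `SereginSverak2002.isSuitableWeakSolutionInBall_vertex` — `(u, q)` is a suitable weak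
  solution in the parabolic ball `Q_c(T, x₀)` for every `0 < c`, `c² ≤ T`, with the classes up to
  the top time (`IsSuitableWeakSolutionInBall`: energy from the Leray–Hopf energy inequality,
  the Leray–Hopf weak gradient, `q ∈ L^{3/2}` of the slab);
* `SereginSverak2002.exists_vertex_cknC_cknD_le` — Type I at the vertex for `C` and `D`
  (`Seregin2020.scaledEnergies_bounded_of_cknAEss_le` fed with the Type I bound on `A` of
  `SereginSverakScaledEnergiesAtVertex.lean`);
* `SereginSverak2002.exists_blowup_limit_at_vertex` — **the blow-up limit**: scales
  `R_j → 0` and a pair `(w, π)` which is a suitable weak solution in every parabolic ball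
  `Q(a)`, `w ∈ L³(Q(a))`, with `R_j u(T + R_j² s, x₀ + R_j y) → w` in `L³(Q(a))` and
  `R_j² q(T + R_j² s, x₀ + R_j y) ⇀ π` against `L³(Q(a))` (the tree's
  `exists_zoom_blowup_limit`, Seregin 2014 Prop. 6.20, applied to the pre-zoomed pair at scale
  `ρ₀`; parabolic zooms compose by `zoom_zoom` of `ESSLocalHolderBlowupLimit.lean`).

## References

* G. Seregin, V. Šverák, Arch. Ration. Mech. Anal. 163 (2002), 65–86 (the result served).
  [SereginSverak2002]
* G. Seregin, *Lecture Notes on Regularity Theory for the Navier–Stokes Equations* (2014),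
  §6.6, Prop. 6.20. [Seregin2014]
-/

noncomputable section

open _root_.MeasureTheory Set Function Filter _root_.Topology TopologicalSpace Metric Real
open scoped NNReal ENNReal RealInnerProductSpace ContDiff

namespace Literature.Analysis.FluidPDE

namespace SereginSverak2002

variable {T : ℝ} {u : ℝ → EuclideanSpace ℝ (Fin 3) → EuclideanSpace ℝ (Fin 3)}
  {p : ℝ → EuclideanSpace ℝ (Fin 3) → ℝ}

/-! ### The gauged pressure on the whole slab -/

/-- The gauged pressure `q = p − (p(t, 0) − p̃[u(t)](0))` of a classical Leray–Hopf solution on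
`[0, T)` is a.e.-strongly measurable on the slab `(0, T) × ℝ³`. [folklore] -/
theorem aestronglyMeasurable_gauge_slab (hT : 0 < T)
    (hsol : IsClassicalNSSolutionOn (Ico 0 T) 1 0 u p) (hLH : IsLerayHopfOn T 1 0 (u 0) u) :
    AEStronglyMeasurable
      (fun z : ℝ × EuclideanSpace ℝ (Fin 3) => p z.1 z.2 - (p z.1 0 - normalisedPressure (u z.1) 0))
      (volume.restrict (Ioo 0 T ×ˢ (univ : Set (EuclideanSpace ℝ (Fin 3))))) := by
  obtain ⟨-, hloc⟩ := exists_pressure_gauge_of_classical one_pos hT hsol hLH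
  have hp : AEStronglyMeasurable (fun z : ℝ × EuclideanSpace ℝ (Fin 3) => p z.1 z.2)
      (volume.restrict (Ioo 0 T ×ˢ (univ : Set (EuclideanSpace ℝ (Fin 3))))) :=
    (hsol.smooth_pressure.continuousOn.mono (prod_mono Ioo_subset_Ico_self subset_rfl)).aestronglyMeasurable
      (measurableSet_Ioo.prod MeasurableSet.univ)
  have hc : AEStronglyMeasurable
      (fun z : ℝ × EuclideanSpace ℝ (Fin 3) => p z.1 0 - normalisedPressure (u z.1) 0)
      (volume.restrict (Ioo 0 T ×ˢ (univ : Set (EuclideanSpace ℝ (Fin 3))))) := by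
    rw [← iUnion_Ioc_sub_div_eq_Ioo hT, iUnion_prod_const, aestronglyMeasurable_iUnion_iff]
    intro n
    have hTn : T - T / ((n : ℝ) + 2) < T := by
      have : 0 < T / ((n : ℝ) + 2) := by positivity
      linarith
    obtain ⟨C, M, hCm, -, hae⟩ := hloc _ hTn
    have hae' : ∀ᵐ z ∂(volume.restrict (Ioc 0 (T - T / ((n : ℝ) + 2)) ×ˢ
        (univ : Set (EuclideanSpace ℝ (Fin 3))))),
        p z.1 0 - normalisedPressure (u z.1) 0 = C z.1 :=
      ae_restrict_prod_univ_of_ae_restrict measurableSet_Ioc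
        (ae_restrict_of_ae_restrict_of_subset Ioc_subset_Icc_self hae)
    exact (hCm.comp measurable_fst).aestronglyMeasurable.congr
      (hae'.mono fun z hz => hz.symm)
  exact hp.sub hc

/-! ### The gauged pair in the parabolic balls at the vertex `(T, x₀)` -/

/-- The backward cylinder `Q_c(T, x₀)`, `c² ≤ T`, lies in the open slab `(0, T) × ℝ³`. [folklore] -/
theorem parabolicCylinder_vertex_subset_slab {c : ℝ} (hcT : c ^ 2 ≤ T)
    (x₀ : EuclideanSpace ℝ (Fin 3)) :
    parabolicCylinder c (T, x₀) ⊆ Ioo 0 T ×ˢ (univ : Set (EuclideanSpace ℝ (Fin 3))) := by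
  rw [parabolicCylinder]
  rintro ⟨t, x⟩ ⟨⟨ht1, ht2⟩, -⟩
  exact ⟨⟨by simp only at ht1; linarith, ht2⟩, mem_univ _⟩

/-- **The gauged pair is a suitable weak solution in every parabolic ball at the vertex.** For a
classical Leray–Hopf solution on `[0, T)` (`ν = 1`), `c² ≤ T` and any `x₀`:
`IsSuitableWeakSolutionInBall c (T, x₀) u q`. [folklore] -/
theorem isSuitableWeakSolutionInBall_vertex (hT : 0 < T)
    (hsol : IsClassicalNSSolutionOn (Ico 0 T) 1 0 u p) (hLH : IsLerayHopfOn T 1 0 (u 0) u)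
    (x₀ : EuclideanSpace ℝ (Fin 3)) {c : ℝ} (hcT : c ^ 2 ≤ T) :
    IsSuitableWeakSolutionInBall c (T, x₀) u
      fun t x => p t x - (p t 0 - normalisedPressure (u t) 0) := by
  have hQslab : (parabolicCylinderOpens c (T, x₀) : Set (ℝ × EuclideanSpace ℝ (Fin 3))) ⊆
      Ioo 0 T ×ˢ (univ : Set (EuclideanSpace ℝ (Fin 3))) := by
    rw [coe_parabolicCylinderOpens]
    exact parabolicCylinder_vertex_subset_slab hcT x₀
  refine ⟨isSuitableWeakSolutionOn_gauge_of_classical one_pos hT hsol hLH _ hQslab, ?_, ?_, ?_⟩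
  · -- `u ∈ L^∞_t L²_x` on the cylinder, from the energy inequality
    refine ⟨(2 * VectorCalculus.kineticEnergy (u 0)).toNNReal, ?_⟩
    filter_upwards [ae_restrict_mem measurableSet_Ioo] with t ht
    have ht1 : T - c ^ 2 < t := by simpa using ht.1
    have ht2 : t < T := by simpa using ht.2
    have ht' : t ∈ Icc 0 T := ⟨by nlinarith, ht2.le⟩
    calc ∫⁻ x in ball (T, x₀).2 c, ‖u t x‖ₑ ^ 2 ≤ ∫⁻ x, ‖u t x‖ₑ ^ 2 :=
          setLIntegral_le_lintegral _ _
      _ ≤ ENNReal.ofReal (2 * VectorCalculus.kineticEnergy (u 0)) := eEnergy_le zero_le_one hLH ht'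
      _ = ((2 * VectorCalculus.kineticEnergy (u 0)).toNNReal : ℝ≥0∞) := rfl
  · -- the Leray–Hopf weak gradient
    obtain ⟨G, hGslab, -, hGint, -⟩ := hLH.exists_hasWeakSpatialGradientOn
    have hle : parabolicCylinderOpens c (T, x₀) ≤
        slab (EuclideanSpace ℝ (Fin 3)) (Ioo 0 T) isOpen_Ioo := by
      intro z hz
      change z ∈ Ioo 0 T ×ˢ (univ : Set (EuclideanSpace ℝ (Fin 3)))
      exact hQslab hz
    refine ⟨G, hGslab.mono hle, lt_of_le_of_lt (lintegral_mono_set ?_) hGint⟩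
    exact parabolicCylinder_vertex_subset_slab hcT x₀
  · -- `q ∈ L^{3/2}` of the cylinder
    refine ⟨(aestronglyMeasurable_gauge_slab hT hsol hLH).mono_measure
      (Measure.restrict_mono (parabolicCylinder_vertex_subset_slab hcT x₀) le_rfl), ?_⟩
    have h32 : ((3 : ℝ≥0∞) / 2).toReal = (3 / 2 : ℝ) := by
      rw [ENNReal.toReal_div]; norm_num
    rw [eLpNorm_lt_top_iff_lintegral_rpow_enorm_lt_top (by simp) (by simp [ENNReal.div_eq_top]),
      h32]
    exact (lintegral_mono_set (parabolicCylinder_vertex_subset_slab hcT x₀)).trans_lt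
      (lintegral_slab_gauged_pressure_lt_top one_pos hT hsol hLH)

/-! ### Type I for `C` and `D` at the vertex -/

/-- **Type I for `C` and `D` at a vertex of the final slice.** Under a one-sided pressure bound
(`K ≥ 0`), for `0 < ρ ≤ 1/2` with `ρ² < T` there is `K₀` with `C(r; (T, x₀)) ≤ K₀` and
`D(r; (T, x₀)) ≤ K₀` (gauged pressure) for all `0 < r ≤ ρ/2`.
[cite: SereginSverak2002, §3; Seregin2020 remark after Def. 1.7] -/
theorem exists_vertex_cknC_cknD_le (hT : 0 < T)
    (hsol : IsClassicalNSSolutionOn (Ico 0 T) 1 0 u p) (hLH : IsLerayHopfOn T 1 0 (u 0) u)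
    {K : ℝ} (hK : 0 ≤ K)
    (hone : (∀ t ∈ Ioo 0 T, ∀ x, ‖u t x‖ ^ 2 / 2 + normalisedPressure (u t) x ≤ K) ∨
      (∀ t ∈ Ioo 0 T, ∀ x, -K ≤ normalisedPressure (u t) x))
    (x₀ : EuclideanSpace ℝ (Fin 3)) {ρ : ℝ} (hρ : 0 < ρ) (hρ1 : ρ ≤ 1 / 2) (hρT : ρ ^ 2 < T) :
    ∃ K₀ : ℝ≥0, ∀ r ∈ Ioc 0 (ρ / 2),
      cknC r (T, x₀) u ≤ K₀ ∧
      cknD r (T, x₀) (fun t x => p t x - (p t 0 - normalisedPressure (u t) 0)) ≤ K₀ := by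
  set z₀ : ℝ × EuclideanSpace ℝ (Fin 3) := (T, x₀) with hz₀
  set Q : Opens (ℝ × EuclideanSpace ℝ (Fin 3)) := parabolicCylinderOpens ρ z₀ with hQdef
  have hQ : (Q : Set (ℝ × EuclideanSpace ℝ (Fin 3))) = parabolicCylinder ρ z₀ := rfl
  have hQslab : (Q : Set (ℝ × EuclideanSpace ℝ (Fin 3))) ⊆
      Ioo 0 T ×ˢ (univ : Set (EuclideanSpace ℝ (Fin 3))) := by
    rw [hQ]; exact parabolicCylinder_vertex_subset_slab hρT.le x₀
  set q : ℝ → EuclideanSpace ℝ (Fin 3) → ℝ :=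
    fun t x => p t x - (p t 0 - normalisedPressure (u t) 0) with hq
  have hsws : IsSuitableWeakSolutionOn Q 1 0 u q :=
    isSuitableWeakSolutionOn_gauge_of_classical one_pos hT hsol hLH Q hQslab
  obtain ⟨G, hGslab, -, hGint, -⟩ := hLH.exists_hasWeakSpatialGradientOn
  have hle : Q ≤ slab (EuclideanSpace ℝ (Fin 3)) (Ioo 0 T) isOpen_Ioo := by
    intro z hz
    change z ∈ Ioo 0 T ×ˢ (univ : Set (EuclideanSpace ℝ (Fin 3)))
    exact hQslab hz
  have hG : HasWeakSpatialGradientOn Q u G := hGslab.mono hle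
  have hρ0 : ENNReal.ofReal ρ ≠ 0 := by rwa [ne_eq, ENNReal.ofReal_eq_zero, not_le]
  have hE₀ : cknE ρ z₀ G ≠ ⊤ := by
    refine ENNReal.mul_ne_top (ENNReal.inv_ne_top.2 hρ0) (ne_top_of_le_ne_top hGint.ne ?_)
    exact lintegral_mono_set (by rw [← hQ]; exact hQslab)
  have hD₀ : cknD ρ z₀ q ≠ ⊤ := by
    refine ENNReal.mul_ne_top (ENNReal.inv_ne_top.2 (pow_ne_zero 2 hρ0))
      (ne_top_of_le_ne_top (lintegral_slab_gauged_pressure_lt_top one_pos hT hsol hLH).ne ?_)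
    exact lintegral_mono_set (by rw [← hQ]; exact hQslab)
  set M : ℝ≥0 := (2 * ((∫ x, ‖u 0 x‖ ^ 2) + 4 * π * K)).toNNReal with hM
  have hMA : ∀ r ∈ Ioc (0 : ℝ) ρ, cknAEss r z₀ u ≤ M := by
    intro r hr
    have h := cknAEss_le_uniform hsol hLH hK hone x₀ hr.1 (hr.2.trans hρ1)
      (by nlinarith [hr.1, hr.2, hρT])
    rw [hM, ENNReal.ofReal] at *
    exact h
  obtain ⟨K₀, hK₀⟩ := Seregin2020.scaledEnergies_bounded_of_cknAEss_le hsws hG hρ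
    (by rw [hQ]) hE₀ hD₀ hMA
  refine ⟨K₀, fun r hr => ⟨?_, ?_⟩⟩
  · exact le_trans (by
      calc cknC r z₀ u ≤ cknAEss r z₀ u + cknE r z₀ G + cknC r z₀ u + cknD r z₀ q :=
            le_add_right le_add_self) (hK₀ r hr)
  · exact le_trans le_add_self (hK₀ r hr)

/-! ### The blow-up limit at the vertex -/

/-- **The blow-up limit of the gauged pair at the vertex `(T, x₀)`.** For a classical Leray–Hopf
solution on `[0, T)` (`ν = 1`) with a one-sided pressure bound (`K ≥ 0`) and a centre `x₀`
there are scales `R_j → 0` (`0 < R_j`) and a pair `(w, π)` such that for every `a > 0`: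
`(w, π)` is a suitable weak solution in the parabolic ball `Q(a)`, `w ∈ L³(Q(a))`,
`R_j u(T + R_j² ·, x₀ + R_j ·) → w` in `L³(Q(a))`, and
`R_j² q(T + R_j² ·, x₀ + R_j ·) ⇀ π` against `L³(Q(a))`, where
`q = p − (p(t, 0) − p̃[u(t)](0))`.
[cite: SereginSverak2002, §4 (blow-up at a singular point); Seregin2014 Prop. 6.20] -/
theorem exists_blowup_limit_at_vertex (hT : 0 < T)
    (hsol : IsClassicalNSSolutionOn (Ico 0 T) 1 0 u p) (hLH : IsLerayHopfOn T 1 0 (u 0) u)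
    {K : ℝ} (hK : 0 ≤ K)
    (hone : (∀ t ∈ Ioo 0 T, ∀ x, ‖u t x‖ ^ 2 / 2 + normalisedPressure (u t) x ≤ K) ∨
      (∀ t ∈ Ioo 0 T, ∀ x, -K ≤ normalisedPressure (u t) x))
    (x₀ : EuclideanSpace ℝ (Fin 3)) :
    ∃ (R : ℕ → ℝ) (w : ℝ → EuclideanSpace ℝ (Fin 3) → EuclideanSpace ℝ (Fin 3))
      (pL : ℝ → EuclideanSpace ℝ (Fin 3) → ℝ),
      (∀ j, 0 < R j) ∧ (∀ j, R j ^ 2 ≤ T) ∧ Tendsto R atTop (𝓝 0) ∧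
      ∀ a : ℝ, 0 < a →
        IsSuitableWeakSolutionInBall a 0 w pL ∧
        MemLp (uncurry w) 3
          (volume.restrict (parabolicCylinder a (0 : ℝ × EuclideanSpace ℝ (Fin 3)))) ∧
        Tendsto (fun j => eLpNorm
            (uncurry ((R j) • stPull ((R j) ^ 2) (R j) T x₀ u) - uncurry w) 3
            (volume.restrict (parabolicCylinder a (0 : ℝ × EuclideanSpace ℝ (Fin 3)))))
          atTop (𝓝 0) ∧
        ∀ g : ℝ × EuclideanSpace ℝ (Fin 3) → ℝ,
          MemLp g 3 (volume.restrict (parabolicCylinder a (0 : ℝ × EuclideanSpace ℝ (Fin 3)))) →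
          Tendsto (fun j => ∫ w' in parabolicCylinder a (0 : ℝ × EuclideanSpace ℝ (Fin 3)),
              ((R j) ^ 2 • stPull ((R j) ^ 2) (R j) T x₀
                  (fun t x => p t x - (p t 0 - normalisedPressure (u t) 0))) w'.1 w'.2 * g w')
            atTop (𝓝 (∫ w' in parabolicCylinder a (0 : ℝ × EuclideanSpace ℝ (Fin 3)),
              pL w'.1 w'.2 * g w')) := by
  -- the pre-zoom scale `ρ₀`
  obtain ⟨ρ₀, hρ₀pos, hρ₀half, hρ₀sqT⟩ : ∃ ρ₀ : ℝ, 0 < ρ₀ ∧ ρ₀ ≤ 1 / 2 ∧ ρ₀ ^ 2 ≤ T / 4 := by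
    refine ⟨min (1 / 2) (Real.sqrt T / 2), lt_min (by norm_num) (by positivity), min_le_left _ _, ?_⟩
    have h0 : 0 ≤ min (1 / 2) (Real.sqrt T / 2) := le_min (by norm_num) (by positivity)
    have h2 := pow_le_pow_left₀ h0 (min_le_right (1 / 2) (Real.sqrt T / 2)) 2
    rw [div_pow, Real.sq_sqrt hT.le] at h2
    linarith
  have hρ₀T : ρ₀ ^ 2 < T := by linarith
  obtain ⟨K₀, hK₀⟩ := exists_vertex_cknC_cknD_le hT hsol hLH hK hone x₀ hρ₀pos hρ₀half hρ₀T
  set q : ℝ → EuclideanSpace ℝ (Fin 3) → ℝ :=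
    fun t x => p t x - (p t 0 - normalisedPressure (u t) 0) with hq
  -- the pre-zoomed pair at scale `ρ₀`
  set v : ℝ → EuclideanSpace ℝ (Fin 3) → EuclideanSpace ℝ (Fin 3) :=
    ρ₀ • stPull (ρ₀ ^ 2) ρ₀ T x₀ u with hv
  set pv : ℝ → EuclideanSpace ℝ (Fin 3) → ℝ := ρ₀ ^ 2 • stPull (ρ₀ ^ 2) ρ₀ T x₀ q with hpv
  -- composition of parabolic zooms (`zoom_zoom`, `ESSLocalHolderBlowupLimit.lean`)
  have hzoomv : ∀ c : ℝ, c • stPull (c ^ 2) c 0 0 v =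
      (c * ρ₀) • stPull ((c * ρ₀) ^ 2) (c * ρ₀) T x₀ u := fun c => by
    rw [hv, zoom_zoom]
  have hzoomp : ∀ c : ℝ, c ^ 2 • stPull (c ^ 2) c 0 0 pv =
      (c * ρ₀) ^ 2 • stPull ((c * ρ₀) ^ 2) (c * ρ₀) T x₀ q := fun c => by
    rw [hpv, zoom_zoom, mul_pow]
  -- measurability of `v` on `Q(1/2)`: continuity
  have hvm : AEStronglyMeasurable (uncurry v)
      (volume.restrict (parabolicCylinder (1 / 2) ((0 : ℝ), (0 : EuclideanSpace ℝ (Fin 3))))) := by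
    have hmaps : MapsTo (fun z : ℝ × EuclideanSpace ℝ (Fin 3) => (T + ρ₀ ^ 2 * z.1, x₀ + ρ₀ • z.2))
        (parabolicCylinder (1 / 2) ((0 : ℝ), (0 : EuclideanSpace ℝ (Fin 3))))
        (Ico 0 T ×ˢ (univ : Set (EuclideanSpace ℝ (Fin 3)))) := by
      intro z hz
      rw [parabolicCylinder] at hz
      obtain ⟨⟨hz1, hz2⟩, -⟩ := hz
      simp only at hz1 hz2
      refine ⟨⟨?_, ?_⟩, mem_univ _⟩
      · show 0 ≤ T + ρ₀ ^ 2 * z.1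
        nlinarith [hρ₀sqT, hz1]
      · show T + ρ₀ ^ 2 * z.1 < T
        nlinarith [mul_neg_of_pos_of_neg (pow_pos hρ₀pos 2) hz2]
    have hcont : ContinuousOn (uncurry v)
        (parabolicCylinder (1 / 2) ((0 : ℝ), (0 : EuclideanSpace ℝ (Fin 3)))) := by
      have hu := hsol.smooth_velocity.continuousOn
      have haff : Continuous fun z : ℝ × EuclideanSpace ℝ (Fin 3) =>
          (T + ρ₀ ^ 2 * z.1, x₀ + ρ₀ • z.2) := by fun_prop
      have := (hu.comp haff.continuousOn hmaps).const_smul ρ₀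
      exact this.congr fun z _ => rfl
    exact hcont.aestronglyMeasurable (isOpen_parabolicCylinder _ _).measurableSet
  -- suitability of all zooms of `v`
  have hsuit : ∀ c ∈ Ioc (0 : ℝ) (1 / 2), IsSuitableWeakSolutionInBall 1 0
      (c • stPull (c ^ 2) c 0 0 v) (c ^ 2 • stPull (c ^ 2) c 0 0 pv) := by
    intro c hc
    have hcc : 0 < c * ρ₀ := mul_pos hc.1 hρ₀pos
    have hccT : (c * ρ₀) ^ 2 ≤ T := by
      have hc1 : c ^ 2 ≤ 1 := by nlinarith [hc.1, hc.2]
      have : (c * ρ₀) ^ 2 ≤ ρ₀ ^ 2 := by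
        rw [mul_pow]; exact mul_le_of_le_one_left (sq_nonneg _) hc1
      linarith
    have h := (isSuitableWeakSolutionInBall_vertex hT hsol hLH x₀ hccT).zoom hcc
    rw [hzoomv, hzoomp]
    exact h
  -- Type I for `C`, `D` of `v` at the origin
  have hM : ∀ r ∈ Ioc (0 : ℝ) (1 / 2), cknC r ((0 : ℝ), (0 : EuclideanSpace ℝ (Fin 3))) v ≤ K₀ := by
    intro r hr
    rw [hv, cknC_zoom hρ₀pos hr.1 (T, x₀) u]
    exact (hK₀ (r * ρ₀) ⟨mul_pos hr.1 hρ₀pos, by nlinarith [hr.2, hρ₀pos]⟩).1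
  have hD : ∀ r ∈ Ioc (0 : ℝ) (1 / 2), cknD r ((0 : ℝ), (0 : EuclideanSpace ℝ (Fin 3))) pv ≤ K₀ := by
    intro r hr
    rw [hpv, cknD_zoom hρ₀pos hr.1 (T, x₀) q]
    exact (hK₀ (r * ρ₀) ⟨mul_pos hr.1 hρ₀pos, by nlinarith [hr.2, hρ₀pos]⟩).2
  -- the tree's blow-up limit
  obtain ⟨δ, w, pL, hδ, -, hlim⟩ := exists_zoom_blowup_limit hvm hsuit hM hD
  -- the scales `R_j = 2^{-(δ j + 2)} ρ₀`
  refine ⟨fun j => (1 / 2 : ℝ) ^ (δ j + 2) * ρ₀, w, pL, fun j => by positivity, fun j => ?_, ?_, ?_⟩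
  · have h1 : ((1 / 2 : ℝ) ^ (δ j + 2) * ρ₀) ^ 2 ≤ ρ₀ ^ 2 := by
      have : (1 / 2 : ℝ) ^ (δ j + 2) ≤ 1 := pow_le_one₀ (by norm_num) (by norm_num)
      rw [mul_pow]
      exact mul_le_of_le_one_left (sq_nonneg _)
        (pow_le_one₀ (pow_nonneg (by norm_num) _) this)
    linarith
  · -- `R_j → 0`
    have hgeo : Tendsto (fun n : ℕ => (1 / 2 : ℝ) ^ n) atTop (𝓝 0) :=
      tendsto_pow_atTop_nhds_zero_of_lt_one (by norm_num) (by norm_num)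
    have h1 : Tendsto (fun j => (1 / 2 : ℝ) ^ (δ j + 2)) atTop (𝓝 0) :=
      hgeo.comp ((tendsto_add_atTop_nat 2).comp hδ.tendsto_atTop)
    simpa using h1.mul_const ρ₀
  · intro a ha
    obtain ⟨h1, h2, h3, h4⟩ := hlim a ha
    refine ⟨h1, h2, ?_, ?_⟩
    · simpa only [hzoomv] using h3
    · intro g hg
      simpa only [hzoomp] using h4 g hg

end SereginSverak2002

end Literature.Analysis.FluidPDE

end
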